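import Mathlib
import Summits.Ventures.PercRepro2.StarHMain
import Summits.Ventures.PercRepro2.StarHCellSets
import Summits.Ventures.PercRepro2.StarHBernSign
import Summits.Ventures.PercRepro2.StarBAtoms
import Summits.Ventures.PercRepro2.HarrisRows
import Summits.Ventures.PercRepro2.PocketBHK
import Summits.Ventures.PercRepro2.StarOEvAlgMain

/-!
# The hub class `{a₁, a₂, o, b}`: (HMF), hence (HCOV), UNCONDITIONAL (blind cell PercRepro2,
night-1 g12; NIGHT1-G12.md)

`HMF_star_h`: for `a₃` adjacent exactly to `a₁` (coin `α`), `a₂` (`β`), `o` (`r`) and `b` (`s`), every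
weight vector, `G − a₃` arbitrary: `0 ≤ HMFc`.  The closed form `HMFc_star_h` (StarHMain) writes `HMFc`
as `hmfcMassH` of the ten cells of the star-zeroed table, the two cluster functionals `G_ob, G′_ob`, the
isolated term `X₀` and the four coins; `form_nonneg` (StarHBernSign — the Bernstein identity with all 65
coefficients certified) gives `0 ≤ Z₁ · hmfcMassH` once the atoms of the table are nonnegative.  The
atoms here: the cells are probabilities; `P_LN = A_L − P_LL − P_LH` etc. by the cell partition
(StarHCellSets / StarHUnions); `sLH, sHL` and `tLL, tHH` are `StarB.same_and_cross` (both root orders);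
`m1, m2` are `StarB.m1_nonneg / m2_nonneg`; `uLL, uHH` are `PocketConn.bhk_same_gshare`; `P_LL ≥ G_ob`,
`P_HH ≥ G′_ob` are `PocketConn.Eprod'_le`; `G_ob, G′_ob ≥ 0`; `Z₁ X₀ = A_L B_H + A_H B_L` is
`StarO.termW_singleton_eq`.  `Z₁ = 0` separately (every mass vanishes).  `HCov_star_h` by `HCov_of_HMF`.
-/

namespace Summit.Ventures.PercRepro2

open StarGlue PendantRoot

namespace StarH

section Class

variable {V : Type*} {E : Type*} [Fintype E] [DecidableEq E] [Fintype V] [DecidableEq V]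
  {R : Type*} [Field R] [LinearOrder R] [IsStrictOrderedRing R]

variable (p : E → R) (ends : E → Sym2 V) {f₁ f₂ f₃ f₄ : E} {a₃ a₁ a₂ o b : V}

open StarO (pOut)

/-- **(HMF) for the hub class `{a₁, a₂, o, b}`**, unconditional: `a₃` adjacent exactly to `a₁` (`f₁`),
`a₂` (`f₂`), `o` (`f₃`) and `b` (`f₄`), every weight vector, `G − a₃` arbitrary. -/
theorem HMF_star_h (hp : IsProbVec p) (hf₁ : ends f₁ = s(a₃, a₁)) (hf₂ : ends f₂ = s(a₃, a₂))
    (hf₃ : ends f₃ = s(a₃, o)) (hf₄ : ends f₄ = s(a₃, b))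
    (hstar : ∀ e, a₃ ∈ ends e → e = f₁ ∨ e = f₂ ∨ e = f₃ ∨ e = f₄)
    (h31 : a₃ ≠ a₁) (h32 : a₃ ≠ a₂) (h3o : a₃ ≠ o) (h3b : a₃ ≠ b) (h12 : f₁ ≠ f₂) (h13 : f₁ ≠ f₃)
    (h14 : f₁ ≠ f₄) (h23 : f₂ ≠ f₃) (h24 : f₂ ≠ f₄) (h34 : f₃ ≠ f₄) :
    HMF p ends o a₁ a₂ a₃ b := by
  unfold HMF
  rw [HMFc_star_h p ends hf₁ hf₂ hf₃ hf₄ hstar h31 h32 h3o h3b h12 h13 h14 h23 h24 h34]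
  set q := pOut p ends a₃ with hq
  have hqp : IsProbVec q := PocketConn.IsProbVec.zeroOn hp _
  -- the natural quantities of the table as cell sums
  have eAL : prob q (avoidAll ends a₂ {a₁} ∩ connEvent ends a₁ o) =
      prob q (cLL ends a₁ a₂ o b) + prob q (cLH ends a₁ a₂ o b) + prob q (cLN ends a₁ a₂ o b) := by
    rw [Q_oL_eq ends a₁ a₂ o b, pu_LL_LH_LN]
  have eAH : prob q (avoidAll ends a₂ {a₁} ∩ connEvent ends a₂ o) =
      prob q (cHL ends a₁ a₂ o b) + prob q (cHH ends a₁ a₂ o b) + prob q (cHN ends a₁ a₂ o b) := by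
    rw [Q_oH_eq ends a₁ a₂ o b, pu_HL_HH_HN]
  have eBL : prob q (avoidAll ends a₂ {a₁} ∩ connEvent ends a₁ b) =
      prob q (cLL ends a₁ a₂ o b) + prob q (cHL ends a₁ a₂ o b) + prob q (cNL ends a₁ a₂ o b) := by
    rw [Q_bL_eq ends a₁ a₂ o b, pu_LL_HL_NL]
  have eBH : prob q (avoidAll ends a₂ {a₁} ∩ connEvent ends a₂ b) =
      prob q (cLH ends a₁ a₂ o b) + prob q (cHH ends a₁ a₂ o b) + prob q (cNH ends a₁ a₂ o b) := by
    rw [Q_bH_eq ends a₁ a₂ o b, pu_LH_HH_NH]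
  have eZ : prob q (avoidAll ends a₂ {a₁}) =
      prob q (cLL ends a₁ a₂ o b) + prob q (cLH ends a₁ a₂ o b) + prob q (cLN ends a₁ a₂ o b) +
        prob q (cHL ends a₁ a₂ o b) + prob q (cHH ends a₁ a₂ o b) + prob q (cHN ends a₁ a₂ o b) +
        prob q (cNL ends a₁ a₂ o b) + prob q (cNH ends a₁ a₂ o b) + prob q (cNNt ends a₁ a₂ o b) +
        prob q (cNNs ends a₁ a₂ o b) := by
    rw [Q_eq ends a₁ a₂ o b, pu_LL_LH_LN_HL_HH_HN_NL_NH_NNt_NNs]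
  have eBN : prob q (avoidAll ends a₂ {a₁} ∩ (connEvent ends a₁ b)ᶜ ∩ (connEvent ends a₂ b)ᶜ) =
      prob q (cLN ends a₁ a₂ o b) + prob q (cHN ends a₁ a₂ o b) + prob q (cNNt ends a₁ a₂ o b) +
        prob q (cNNs ends a₁ a₂ o b) := by
    rw [Q_bN_eq ends a₁ a₂ o b, pu_LN_HN_NNt_NNs]
  -- the five basic cells as natural events
  have eLL : prob q (cLL ends a₁ a₂ o b) =
      prob q (avoidAll ends a₂ {a₁} ∩ connEvent ends a₁ o ∩ connEvent ends a₁ b) := by rw [cLL_eq]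
  have eLH : prob q (cLH ends a₁ a₂ o b) =
      prob q (avoidAll ends a₂ {a₁} ∩ connEvent ends a₁ o ∩ connEvent ends a₂ b) := by rw [cLH_eq]
  have eHL : prob q (cHL ends a₁ a₂ o b) =
      prob q (avoidAll ends a₂ {a₁} ∩ connEvent ends a₂ o ∩ connEvent ends a₁ b) := by rw [cHL_eq]
  have eHH : prob q (cHH ends a₁ a₂ o b) =
      prob q (avoidAll ends a₂ {a₁} ∩ connEvent ends a₂ o ∩ connEvent ends a₂ b) := by rw [cHH_eq]
  -- the functionals
  have hGob : 0 ≤ PocketConn.Eprod' q ends o a₁ a₂ b := by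
    unfold PocketConn.Eprod'
    refine expect_nonneg hqp fun ω => ?_
    refine mul_nonneg (mul_nonneg ?_ ?_) (Set.indicator_nonneg (fun _ _ => zero_le_one) _)
    · exact prob_nonneg hqp _
    · exact prob_nonneg hqp _
  have hGpob : 0 ≤ PocketConn.Eprod' q ends o a₂ a₁ b := by
    unfold PocketConn.Eprod'
    refine expect_nonneg hqp fun ω => ?_
    refine mul_nonneg (mul_nonneg ?_ ?_) (Set.indicator_nonneg (fun _ _ => zero_le_one) _)
    · exact prob_nonneg hqp _
    · exact prob_nonneg hqp _
  have hhLL : 0 ≤ prob q (cLL ends a₁ a₂ o b) - PocketConn.Eprod' q ends o a₁ a₂ b := by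
    have h := PocketConn.Eprod'_le q ends hqp o a₁ a₂ b
    rw [cLL_eq'] at h
    linarith
  have hhHH : 0 ≤ prob q (cHH ends a₁ a₂ o b) - PocketConn.Eprod' q ends o a₂ a₁ b := by
    have h := PocketConn.Eprod'_le q ends hqp o a₂ a₁ b
    rw [cHH_eq'] at h
    linarith
  by_cases hZ : prob q (avoidAll ends a₂ {a₁}) = 0
  · -- every cell vanishes, both functionals vanish, the form vanishes
    have hle : ∀ X, X ⊆ avoidAll ends a₂ {a₁} → prob q X = 0 := fun X hX =>
      le_antisymm (hZ ▸ prob_mono hqp hX) (prob_nonneg hqp _)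
    have hc : ∀ A B C D F : Set (Config E),
        avoidAll ends a₂ {a₁} ∩ A ∩ B ∩ C ∩ D ∩ F ⊆ avoidAll ends a₂ {a₁} :=
      fun A B C D F ω hω => hω.1.1.1.1.1
    have zLL : prob q (cLL ends a₁ a₂ o b) = 0 := hle _ (hc _ _ _ _ _)
    have zLH : prob q (cLH ends a₁ a₂ o b) = 0 := hle _ (hc _ _ _ _ _)
    have zLN : prob q (cLN ends a₁ a₂ o b) = 0 := hle _ (hc _ _ _ _ _)
    have zHL : prob q (cHL ends a₁ a₂ o b) = 0 := hle _ (hc _ _ _ _ _)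
    have zHH : prob q (cHH ends a₁ a₂ o b) = 0 := hle _ (hc _ _ _ _ _)
    have zHN : prob q (cHN ends a₁ a₂ o b) = 0 := hle _ (hc _ _ _ _ _)
    have zNL : prob q (cNL ends a₁ a₂ o b) = 0 := hle _ (hc _ _ _ _ _)
    have zNH : prob q (cNH ends a₁ a₂ o b) = 0 := hle _ (hc _ _ _ _ _)
    have zNNt : prob q (cNNt ends a₁ a₂ o b) = 0 := hle _ (hc _ _ _ _ _)
    have zNNs : prob q (cNNs ends a₁ a₂ o b) = 0 := hle _ (hc _ _ _ _ _)
    have zG : PocketConn.Eprod' q ends o a₁ a₂ b = 0 := by linarith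
    have zG' : PocketConn.Eprod' q ends o a₂ a₁ b = 0 := by linarith
    rw [zLL, zLH, zLN, zHL, zHH, zHN, zNL, zNH, zNNt, zNNs, zG, zG']
    unfold hmfcMassH hubMass_Q hubMass_PD hubMass_PDoL hubMass_PDoH hubMass_PDbH hubMass_T
      hubMass_TbH hubMass_TbL hubMass_ToL hubMass_ToH hubMass_Tp hubMass_TpoL hubMass_TpoH
      hubMass_QoL hubMass_QoH hubMass_QbH hubMass_QbL xhatH
    ring_nf
    exact le_refl _
  · have hZpos : 0 < prob q (avoidAll ends a₂ {a₁}) :=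
      lt_of_le_of_ne (prob_nonneg hqp _) (Ne.symm hZ)
    have hX0 := StarO.termW_singleton_eq p ends h31 h32 h3o h3b hZ
    -- the BHK atoms in the natural vocabulary
    have hsLH : 0 ≤ prob q (avoidAll ends a₂ {a₁} ∩ connEvent ends a₁ o) *
        prob q (avoidAll ends a₂ {a₁} ∩ connEvent ends a₂ b) -
        prob q (avoidAll ends a₂ {a₁}) *
          prob q (avoidAll ends a₂ {a₁} ∩ connEvent ends a₁ o ∩ connEvent ends a₂ b) := by
      have h := (StarB.same_and_cross q ends hqp o a₁ a₂ b).2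
      rw [mul_comm] at h
      linarith
    have hsHL : 0 ≤ prob q (avoidAll ends a₂ {a₁} ∩ connEvent ends a₂ o) *
        prob q (avoidAll ends a₂ {a₁} ∩ connEvent ends a₁ b) -
        prob q (avoidAll ends a₂ {a₁}) *
          prob q (avoidAll ends a₂ {a₁} ∩ connEvent ends a₂ o ∩ connEvent ends a₁ b) := by
      have h := (StarB.same_and_cross q ends hqp o a₂ a₁ b).2
      rw [StarO.avoidAll_swap, mul_comm] at h
      linarith
    have htHH : 0 ≤ prob q (avoidAll ends a₂ {a₁}) *
        prob q (avoidAll ends a₂ {a₁} ∩ connEvent ends a₂ o ∩ connEvent ends a₂ b) -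
        prob q (avoidAll ends a₂ {a₁} ∩ connEvent ends a₂ o) *
          prob q (avoidAll ends a₂ {a₁} ∩ connEvent ends a₂ b) := by
      have h := (StarB.same_and_cross q ends hqp o a₁ a₂ b).1
      rw [mul_comm _ (prob q (avoidAll ends a₂ {a₁}))] at h
      linarith
    have htLL : 0 ≤ prob q (avoidAll ends a₂ {a₁}) *
        prob q (avoidAll ends a₂ {a₁} ∩ connEvent ends a₁ o ∩ connEvent ends a₁ b) -
        prob q (avoidAll ends a₂ {a₁} ∩ connEvent ends a₁ o) *
          prob q (avoidAll ends a₂ {a₁} ∩ connEvent ends a₁ b) := by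
      have h := (StarB.same_and_cross q ends hqp o a₂ a₁ b).1
      rw [StarO.avoidAll_swap, mul_comm _ (prob q (avoidAll ends a₂ {a₁}))] at h
      linarith
    have hm1 := StarB.m1_nonneg q ends hqp o a₁ a₂ b
    have hm2' := StarB.m2_nonneg q ends hqp o a₁ a₂ b
    -- the functional atoms `uLL`, `uHH`
    have eQ : (connEvent ends a₂ a₁)ᶜ = avoidAll ends a₂ {a₁} := by
      rw [avoidAll_eq_compl, connEvent_comm]
    have eQ' : (connEvent ends a₁ a₂)ᶜ = avoidAll ends a₂ {a₁} := (avoidAll_eq_compl _ _ _).symm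
    have eXQ : ∀ X : Set (Config E), X ∩ avoidAll ends a₂ {a₁} = avoidAll ends a₂ {a₁} ∩ X :=
      fun X => Set.inter_comm _ _
    have huLL : 0 ≤ prob q (avoidAll ends a₂ {a₁}) * PocketConn.Eprod' q ends o a₁ a₂ b -
        prob q (avoidAll ends a₂ {a₁} ∩ connEvent ends a₁ o) *
          prob q (avoidAll ends a₂ {a₁} ∩ connEvent ends a₁ b) := by
      have h := PocketConn.bhk_same_gshare q ends hqp o a₁ a₂ b
      rw [eQ, eXQ, eXQ] at h
      linarith
    have huHH : 0 ≤ prob q (avoidAll ends a₂ {a₁}) * PocketConn.Eprod' q ends o a₂ a₁ b -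
        prob q (avoidAll ends a₂ {a₁} ∩ connEvent ends a₂ o) *
          prob q (avoidAll ends a₂ {a₁} ∩ connEvent ends a₂ b) := by
      have h := PocketConn.bhk_same_gshare q ends hqp o a₂ a₁ b
      rw [eQ', eXQ, eXQ] at h
      linarith
    -- the cells `LN, HN, NL, NH, NNs` in the natural vocabulary
    have eLN : prob q (cLN ends a₁ a₂ o b) =
        prob q (avoidAll ends a₂ {a₁} ∩ connEvent ends a₁ o) - prob q (cLL ends a₁ a₂ o b) -
          prob q (cLH ends a₁ a₂ o b) := by linarith
    have eHN : prob q (cHN ends a₁ a₂ o b) =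
        prob q (avoidAll ends a₂ {a₁} ∩ connEvent ends a₂ o) - prob q (cHL ends a₁ a₂ o b) -
          prob q (cHH ends a₁ a₂ o b) := by linarith
    have eNL : prob q (cNL ends a₁ a₂ o b) =
        prob q (avoidAll ends a₂ {a₁} ∩ connEvent ends a₁ b) - prob q (cLL ends a₁ a₂ o b) -
          prob q (cHL ends a₁ a₂ o b) := by linarith
    have eNH : prob q (cNH ends a₁ a₂ o b) =
        prob q (avoidAll ends a₂ {a₁} ∩ connEvent ends a₂ b) - prob q (cLH ends a₁ a₂ o b) -
          prob q (cHH ends a₁ a₂ o b) := by linarith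
    have eNNs : prob q (cNNs ends a₁ a₂ o b) =
        prob q (avoidAll ends a₂ {a₁}) - prob q (avoidAll ends a₂ {a₁} ∩ connEvent ends a₁ o) -
          prob q (avoidAll ends a₂ {a₁} ∩ connEvent ends a₂ o) -
          prob q (avoidAll ends a₂ {a₁} ∩ connEvent ends a₁ b) -
          prob q (avoidAll ends a₂ {a₁} ∩ connEvent ends a₂ b) + prob q (cLL ends a₁ a₂ o b) +
          prob q (cLH ends a₁ a₂ o b) + prob q (cHL ends a₁ a₂ o b) + prob q (cHH ends a₁ a₂ o b) -
          prob q (cNNt ends a₁ a₂ o b) := by linarith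
    have hLN : 0 ≤ prob q (avoidAll ends a₂ {a₁} ∩ connEvent ends a₁ o) - prob q (cLL ends a₁ a₂ o b) -
        prob q (cLH ends a₁ a₂ o b) := by rw [← eLN]; exact prob_nonneg hqp _
    have hHN : 0 ≤ prob q (avoidAll ends a₂ {a₁} ∩ connEvent ends a₂ o) - prob q (cHL ends a₁ a₂ o b) -
        prob q (cHH ends a₁ a₂ o b) := by rw [← eHN]; exact prob_nonneg hqp _
    have hNL : 0 ≤ prob q (avoidAll ends a₂ {a₁} ∩ connEvent ends a₁ b) - prob q (cLL ends a₁ a₂ o b) -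
        prob q (cHL ends a₁ a₂ o b) := by rw [← eNL]; exact prob_nonneg hqp _
    have hNH : 0 ≤ prob q (avoidAll ends a₂ {a₁} ∩ connEvent ends a₂ b) - prob q (cLH ends a₁ a₂ o b) -
        prob q (cHH ends a₁ a₂ o b) := by rw [← eNH]; exact prob_nonneg hqp _
    have hNNs : 0 ≤ prob q (avoidAll ends a₂ {a₁}) - prob q (avoidAll ends a₂ {a₁} ∩ connEvent ends a₁ o) -
        prob q (avoidAll ends a₂ {a₁} ∩ connEvent ends a₂ o) -
        prob q (avoidAll ends a₂ {a₁} ∩ connEvent ends a₁ b) -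
        prob q (avoidAll ends a₂ {a₁} ∩ connEvent ends a₂ b) + prob q (cLL ends a₁ a₂ o b) +
        prob q (cLH ends a₁ a₂ o b) + prob q (cHL ends a₁ a₂ o b) + prob q (cHH ends a₁ a₂ o b) -
        prob q (cNNt ends a₁ a₂ o b) := by rw [← eNNs]; exact prob_nonneg hqp _
    -- the `m` atoms in the cell vocabulary
    have hm1c : 0 ≤ (prob q (avoidAll ends a₂ {a₁} ∩ connEvent ends a₁ o) - prob q (cLL ends a₁ a₂ o b) -
          prob q (cLH ends a₁ a₂ o b)) * prob q (avoidAll ends a₂ {a₁} ∩ connEvent ends a₂ b) -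
        prob q (cLH ends a₁ a₂ o b) * (prob q (avoidAll ends a₂ {a₁}) -
          prob q (avoidAll ends a₂ {a₁} ∩ connEvent ends a₁ b) -
          prob q (avoidAll ends a₂ {a₁} ∩ connEvent ends a₂ b)) := by
      rw [cLN_eq, eLN] at hm1
      have eBN' : prob q (avoidAll ends a₂ {a₁} ∩ (connEvent ends a₁ b)ᶜ ∩ (connEvent ends a₂ b)ᶜ) =
          prob q (avoidAll ends a₂ {a₁}) - prob q (avoidAll ends a₂ {a₁} ∩ connEvent ends a₁ b) -
            prob q (avoidAll ends a₂ {a₁} ∩ connEvent ends a₂ b) := by linarith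
      rw [eBN', ← eLH] at hm1
      exact hm1
    have hm2c : 0 ≤ (prob q (avoidAll ends a₂ {a₁} ∩ connEvent ends a₂ o) - prob q (cHL ends a₁ a₂ o b) -
          prob q (cHH ends a₁ a₂ o b)) * prob q (avoidAll ends a₂ {a₁} ∩ connEvent ends a₁ b) -
        prob q (cHL ends a₁ a₂ o b) * (prob q (avoidAll ends a₂ {a₁}) -
          prob q (avoidAll ends a₂ {a₁} ∩ connEvent ends a₁ b) -
          prob q (avoidAll ends a₂ {a₁} ∩ connEvent ends a₂ b)) := by
      rw [cHN_eq, eHN] at hm2'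
      have eBN' : prob q (avoidAll ends a₂ {a₁} ∩ (connEvent ends a₁ b)ᶜ ∩ (connEvent ends a₂ b)ᶜ) =
          prob q (avoidAll ends a₂ {a₁}) - prob q (avoidAll ends a₂ {a₁} ∩ connEvent ends a₁ b) -
            prob q (avoidAll ends a₂ {a₁} ∩ connEvent ends a₂ b) := by linarith
      rw [eBN', ← eHL] at hm2'
      exact hm2'
    -- the sign theorem of the algebraic half
    rw [eLN, eHN, eNL, eNH, eNNs, eLL, eLH, eHL, eHH]
    rw [eLL] at hhLL
    rw [eHH] at hhHH
    rw [eLL, eLH] at hLN hm1c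
    rw [eHL, eHH] at hHN hm2c
    rw [eLL, eHL] at hNL
    rw [eLH, eHH] at hNH
    rw [eLL, eLH, eHL, eHH] at hNNs
    have key := form_nonneg hX0
      (prob_nonneg hqp (avoidAll ends a₂ {a₁} ∩ connEvent ends a₁ o ∩ connEvent ends a₁ b))
      (prob_nonneg hqp (avoidAll ends a₂ {a₁} ∩ connEvent ends a₁ o ∩ connEvent ends a₂ b))
      (prob_nonneg hqp (avoidAll ends a₂ {a₁} ∩ connEvent ends a₂ o ∩ connEvent ends a₁ b))
      (prob_nonneg hqp (avoidAll ends a₂ {a₁} ∩ connEvent ends a₂ o ∩ connEvent ends a₂ b))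
      (prob_nonneg hqp (cNNt ends a₁ a₂ o b)) hGob hGpob hLN hHN hNL hNH hNNs hhLL hhHH hsLH hsHL
      htLL htHH huLL huHH hm1c hm2c (hp.nonneg f₁) (hp.le_one f₁) (hp.nonneg f₂) (hp.le_one f₂)
      (hp.nonneg f₃) (hp.le_one f₃) (hp.nonneg f₄) (hp.le_one f₄)
    exact (mul_nonneg_iff_of_pos_left hZpos).1 key

/-- **(HCOV) for the hub class `{a₁, a₂, o, b}`**, unconditional. -/
theorem HCov_star_h (hp : IsProbVec p) (hf₁ : ends f₁ = s(a₃, a₁)) (hf₂ : ends f₂ = s(a₃, a₂))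
    (hf₃ : ends f₃ = s(a₃, o)) (hf₄ : ends f₄ = s(a₃, b))
    (hstar : ∀ e, a₃ ∈ ends e → e = f₁ ∨ e = f₂ ∨ e = f₃ ∨ e = f₄)
    (h31 : a₃ ≠ a₁) (h32 : a₃ ≠ a₂) (h3o : a₃ ≠ o) (h3b : a₃ ≠ b) (h12 : f₁ ≠ f₂) (h13 : f₁ ≠ f₃)
    (h14 : f₁ ≠ f₄) (h23 : f₂ ≠ f₃) (h24 : f₂ ≠ f₄) (h34 : f₃ ≠ f₄) :
    CovForm.HCov p ends o a₁ a₂ a₃ b :=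
  HCov_of_HMF p hp ends o a₁ a₂ a₃ b
    (HMF_star_h p ends hp hf₁ hf₂ hf₃ hf₄ hstar h31 h32 h3o h3b h12 h13 h14 h23 h24 h34)

end Class

end StarH

end Summit.Ventures.PercRepro2
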